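import Summits.CriticalPhenomena.PercolationContinuityZ3.Theorems.PercNearOneGluingNoHeavyQuantGatedSliceMixLawAssembly
import Summits.CriticalPhenomena.PercolationContinuityZ3.Theorems.PercNearOneGluingNoHeavyQuantGatedSliceMixLawCellsEasy
import Summits.CriticalPhenomena.PercolationContinuityZ3.Theorems.PercNearOneGluingNoHeavyQuantGatedSliceMixLawCellQ4p
import HarnessLib

/-!
# QUANT lane R8, T-DEC, leg (III), blob case — `LawDec.GatedSliceMixLaw'` ASSEMBLED FROM ITS CELLS, CORRECTED: the refuted Q-alone cell
# `MixLawCellQ3` (unsaturated mid — census-2 g61 / ARM-REF g83 witness) replaced by the MIXTURE cell `MixLawCellA5`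

builds on p205010 (kernel theorem, internal audit signed; external expert review pending)

Support file (`--supports stmt-CriticalPhenomena-4575`), QUANT lane typer seat prim-quant-stmt (gen 30), rung R8 of
`run/shared/lean/prim/quant/LADDER.md`.  Memo `run/shared/lean/prim/quant/prim-quant-stmt-g30/MIXLAW-MIXTURES-G30.md` §6.  Theorems only,
standard axioms, no sorries; CONDITIONAL on the `@[conjecture]` cells of `…QuantGatedSliceMixLawCells` (taken as hypotheses).

WHY.  `…QuantGatedSliceMixLawAssembly` (`gatedSliceMixLaw'_of_cells`) takes `MixLawCellQ3` (the moved law DEC by itself whenever its mid `k₂` can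
absorb the whole shifted low) as an antecedent; that cell is FALSE (witness `y = 15/26, z = 0, g = 3/5, S = 15/2, λ = 9/20, a = 1, j = M = 13,
k₁ = 3, k₂ = 13`: the moved law is not DEC, the instance is a genuine mixture).  The case tree is unchanged; the unsaturated branch of regime A now
invokes the mixture cell `MixLawCellA5` (full frame, weak-mid law present; seat census 400 P-deficient instances / 0 failures of the exchange plan
"k₂ ← all of ℓ, k₁ → W's mids, zeros → giants + k₂'s leftover").  Regime B's unsaturated sub-cell is inside `MixLawRegimeB` (census-2).

* **`LawDec.gatedSliceMixLaw'_of_cellsA`** — `MixLawCellQ1 → MixLawCellQ2 → MixLawCellA5 → MixLawCellQ4 → MixLawCellQ4p → MixLawCellQH →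
  MixLawCellQK → MixLawCellQD → MixLawRegimeB → GatedSliceMixLaw'` (Q1, Q2, Q4p, QD are already theorems: `…CellsEasy`, `…CellQ4p`).
* `LawDec.gatedSliceWindowDEC_of_cellsA`, `LawDec.sdecUpTo_slice_blob_of_cellsA` — CW and the blob case of leg (III) from the corrected cells.
* `LawDec.gatedSliceMixLaw'_of_residualCells` — the same with the four discharged cells removed:
  `MixLawCellA5 → MixLawCellQ4 → MixLawCellQH → MixLawCellQK → MixLawRegimeB → GatedSliceMixLaw'`.

[this work]; regimes C1–C4: this seat; Q-alone cells: arm-1 g41 / arm-2; regime B: census-2 g60/g61 (lead g32 ruling).  The gluing rows served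
[cite: KozmaNitzan2024, Conjecture 3 (p. 15)]; product measure [cite: Grimmett1999, §1.3 p. 10].
-/

noncomputable section

namespace Summit.CriticalPhenomena.PercolationContinuityZ3.Theorems

namespace Quant

open Finset

/-- the two-point law `{lo, hi; g}` (as in `…QuantLawDEC`) -/
local notation3 "TP[" lo ", " hi ", " g ", " h "]" =>
  (g : ℝ) * (if (h : ℕ) = (hi : ℕ) then (1 : ℝ) else 0) + (1 - (g : ℝ)) * (if (h : ℕ) = (lo : ℕ) then (1 : ℝ) else 0)

namespace LawDec

set_option maxHeartbeats 800000 in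
/-- **`GatedSliceMixLaw'` FROM ITS (CORRECTED) CELLS**: as `gatedSliceMixLaw'_of_cells` with the mixture cell `MixLawCellA5` in place of the
refuted `MixLawCellQ3`. [this work] -/
theorem gatedSliceMixLaw'_of_cellsA (hQ1 : MixLawCellQ1) (hQ2 : MixLawCellQ2) (hA5 : MixLawCellA5) (hQ4 : MixLawCellQ4)
    (hQ4p : MixLawCellQ4p) (hQH : MixLawCellQH) (hQK : MixLawCellQK) (hQD : MixLawCellQD) (hB : MixLawRegimeB) :
    GatedSliceMixLaw' := by
  intro y z g S lam a j M h k₁ k₂ hy0 hy1 hz0 hz1 hg1 hyg ha hjM hS0 hta hhj hhM hSh hW hk hk₂M hlam0 hlam1 hmean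
  have hSj : S < (j : ℝ) := lt_of_lt_of_le hSh (by exact_mod_cast hhj)
  have hSM : S < (M : ℝ) := lt_of_lt_of_le hSh (by exact_mod_cast hhM)
  have conc := gatedSliceMixLaw_of_decP y z g S lam a j M h k₁ k₂
  -- QH: the blob dominates the mean (covers `h` a `t`-low)
  by_cases hQHc : 2 * S < S + (a : ℝ) * g * (1 - z)
  · exact conc (hQH y z g S lam a j M k₁ k₂ hy0 hy1 hz0 hz1 hg1 hyg ha hjM hS0 hta hSj hSM hk hk₂M hlam0 hlam1 hmean hQHc)
  have hhmid : S + (a : ℝ) * g * (1 - z) ≤ 2 * (h : ℝ) := by linarith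
  -- Q2: k₁ not a t-low
  by_cases hk1low : k₁ ≤ j ∧ 2 * (k₁ : ℝ) < S + (a : ℝ) * g * (1 - z)
  swap
  · exact conc (hQ2 y z g S lam a j M k₁ k₂ hy0 hy1 hz0 hz1 hg1 hyg ha hjM hS0 hta hSj hSM hk hk₂M hlam0 hlam1 hmean hk1low)
  obtain ⟨hk₁j, hk₁low⟩ := hk1low
  -- Q1: no giant
  by_cases hQ1c : k₂ + a ≤ j
  · exact conc (hQ1 y z g S lam a j M k₁ k₂ hy0 hy1 hz0 hz1 hg1 hyg ha hjM hS0 hta hSj hSM hk hk₂M hlam0 hlam1 hmean hQ1c)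
  have hk₂aG : j + 1 ≤ k₂ + a := by omega
  -- twin a giant
  by_cases hlG : j + 1 ≤ k₁ + a
  · exact conc (decAtT_movedTwoPoint_of_twin_giant y z g S lam a j M k₁ k₂ hy0 hy1 hz0 hz1 hg1 hyg hk hk₂M hlam0 hlam1 hlG)
  have hlj : k₁ + a ≤ j := by omega
  -- regime B
  by_cases hBc : j + 1 ≤ h + a
  · exact hB y z g S lam a j M h k₁ k₂ hy0 hy1 hz0 hz1 hg1 hyg ha hjM hS0 hta hhj hhM hSh hW hk hk₂M hlam0 hlam1 hmean hk₁j hk₁low hlj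
      hk₂aG (by linarith) hBc
  have hhaj : h + a ≤ j := by omega
  -- regime A
  by_cases hllow : 2 * ((k₁ + a : ℕ) : ℝ) < S + (a : ℝ) * g * (1 - z)
  · -- the shifted low is a t-low
    by_cases hk₂G : j + 1 ≤ k₂
    · exact gatedSliceMixLaw_regimeC1 y z g S lam a j M h k₁ k₂ hy0 hy1 hz0 hz1 hg1 hyg hjM hS0 hta hhM hSh hk hk₂M hlam0 hlam1 hmean
        hllow hlj hk₂G hhaj hhmid
    have hk₂j : k₂ ≤ j := by omega
    by_cases hk₂low : 2 * (k₂ : ℝ) < S + (a : ℝ) * g * (1 - z)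
    · exact conc (hQK y z g S lam a j M k₁ k₂ hy0 hy1 hz0 hz1 hg1 hyg ha hjM hS0 hta hSj hSM hk hk₂M hlam0 hlam1 hmean hk₂j hk₂low)
    have hk₂mid : S + (a : ℝ) * g * (1 - z) ≤ 2 * (k₂ : ℝ) := not_lt.1 hk₂low
    by_cases hcomp : S + (a : ℝ) * g * (1 - z) < ((k₁ + a : ℕ) : ℝ) + k₂
    swap
    · exact conc (hQD y z g S lam a j M k₁ k₂ hy0 hy1 hz0 hz1 hg1 hyg ha hjM hS0 hta hSj hSM hk hk₂M hlam0 hlam1 hmean (not_lt.1 hcomp))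
    by_cases hsat : (1 - z) * lam * (1 - g) ≤ (1 - z) * (1 - lam) * g * usage y (S + (a : ℝ) * g * (1 - z)) j (k₁ + a) k₂
    · exact gatedSliceMixLaw_regimeC2 y z g S lam a j M h k₁ k₂ hy0 hy1 hz0 hz1 hg1 hyg hjM hS0 hta hhM hSh hk hk₂M hlam0 hlam1 hmean
        hllow hlj hk₂j hk₂mid hcomp hk₂aG hhaj hhmid hsat
    · exact hA5 y z g S lam a j M h k₁ k₂ hy0 hy1 hz0 hz1 hg1 hyg ha hjM hS0 hta hhj hhM hSh hW hk hk₂M hlam0 hlam1 hmean hllow hlj hk₂j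
        hk₂mid hcomp hk₂aG (not_le.1 hsat).le hhaj hhmid
  · -- the twin is not a t-low
    have hlmid : S + (a : ℝ) * g * (1 - z) ≤ 2 * ((k₁ + a : ℕ) : ℝ) := not_lt.1 hllow
    by_cases hlt : ((k₁ + a : ℕ) : ℝ) ≤ S + (a : ℝ) * g * (1 - z)
    · by_cases hk₂G : j + 1 ≤ k₂
      · exact gatedSliceMixLaw_regimeC3 y z g S lam a j M h k₁ k₂ hy0 hy1 hz0 hz1 hg1 hyg hS0 hta hhM hSh hk hk₂M hlam0 hlam1 hmean
          hk₁low hlj hlmid hlt hk₂G hhaj hhmid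
      · exact conc (hQ4 y z g S lam a j M k₁ k₂ hy0 hy1 hz0 hz1 hg1 hyg ha hjM hS0 hta hSj hSM hk hk₂M hlam0 hlam1 hmean hk₁j hk₁low
          hlj hlmid (by omega))
    · have hlt' : S + (a : ℝ) * g * (1 - z) < ((k₁ + a : ℕ) : ℝ) := not_le.1 hlt
      by_cases hk₂G : j + 1 ≤ k₂
      · by_cases hsat : (1 - z) * (1 - lam) * g ≤ (1 - z) * (1 - lam) * (1 - g) * usage y (S + (a : ℝ) * g * (1 - z)) j k₁ (k₁ + a)
        · exact gatedSliceMixLaw_regimeC4 y z g S lam a j M h k₁ k₂ hy0 hy1 hz0 hz1 hg1 hyg hS0 hta hhM hSh hk hk₂M hlam0 hlam1 hmean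
            hk₁low hlj hlt' hsat hk₂G hhaj hhmid
        · exact conc (hQ4p y z g S lam a j M k₁ k₂ hy0 hy1 hz0 hz1 hg1 hyg ha hjM hS0 hta hSj hSM hk hk₂M hlam0 hlam1 hmean hk₁j hk₁low
            hlj hlt' hk₂G (not_le.1 hsat).le)
      · exact conc (hQ4 y z g S lam a j M k₁ k₂ hy0 hy1 hz0 hz1 hg1 hyg ha hjM hS0 hta hSj hSM hk hk₂M hlam0 hlam1 hmean hk₁j hk₁low
          hlj hlmid (by omega))


/-- **CW FROM THE CORRECTED CELLS**. [this work] -/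
theorem gatedSliceWindowDEC_of_cellsA (hQ1 : MixLawCellQ1) (hQ2 : MixLawCellQ2) (hA5 : MixLawCellA5) (hQ4 : MixLawCellQ4)
    (hQ4p : MixLawCellQ4p) (hQH : MixLawCellQH) (hQK : MixLawCellQK) (hQD : MixLawCellQD) (hB : MixLawRegimeB) :
    GatedSliceWindowDEC :=
  gatedSliceWindowDEC_of_mixLaw' (gatedSliceMixLaw'_of_cellsA hQ1 hQ2 hA5 hQ4 hQ4p hQH hQK hQD hB)

/-- **THE BLOB CASE OF LEG (III) FROM THE CORRECTED CELLS**. [this work] -/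
theorem sdecUpTo_slice_blob_of_cellsA (hQ1 : MixLawCellQ1) (hQ2 : MixLawCellQ2) (hA5 : MixLawCellA5) (hQ4 : MixLawCellQ4)
    (hQ4p : MixLawCellQ4p) (hQH : MixLawCellQH) (hQK : MixLawCellQK) (hQD : MixLawCellQD) (hB : MixLawRegimeB)
    (x Q g : ℝ) (M a : ℕ) (μ : ℕ → ℝ) (hx0 : 0 < x) (hQ1' : Q ≤ 1)
    (hQx : Q * x < 1) (hxg : x ≤ g) (hg1 : g ≤ 1) (ha : 1 ≤ a) (hμ0 : ∀ h, 0 ≤ μ h) (hμM : ∀ h, M < h → μ h = 0)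
    (hμ1 : ∑ h ∈ Finset.range (M + 1), μ h = 1)
    (hta : x * (M : ℝ) ≤ ∑ h ∈ Finset.range (M + 1), (h : ℝ) * μ h)
    (hS : SDECUpTo x Q M μ) :
    SDECUpTo x Q (M + a) (slice μ a g) :=
  sdecUpTo_slice_blob_of_mixLaw' (gatedSliceMixLaw'_of_cellsA hQ1 hQ2 hA5 hQ4 hQ4p hQH hQK hQD hB) x Q g M a μ hx0 hQ1' hQx hxg hg1 ha
    hμ0 hμM hμ1 hta hS

/-- **`GatedSliceMixLaw'` FROM THE RESIDUAL CELLS** (Q1, Q2, Q4′, QD already discharged: `mixLawCellQ1_holds`, `mixLawCellQ2_holds`,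
`mixLawCellQ4p_holds`, `mixLawCellQD_holds`): `MixLawCellA5 → MixLawCellQ4 → MixLawCellQH → MixLawCellQK → MixLawRegimeB → GatedSliceMixLaw'`. [this work] -/
theorem gatedSliceMixLaw'_of_residualCells (hA5 : MixLawCellA5) (hQ4 : MixLawCellQ4) (hQH : MixLawCellQH) (hQK : MixLawCellQK)
    (hB : MixLawRegimeB) : GatedSliceMixLaw' :=
  gatedSliceMixLaw'_of_cellsA mixLawCellQ1_holds mixLawCellQ2_holds hA5 hQ4 mixLawCellQ4p_holds hQH hQK mixLawCellQD_holds hB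

end LawDec

end Quant

end Summit.CriticalPhenomena.PercolationContinuityZ3.Theorems
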